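import Summits.QuantumFields.YangMills.Theorems.BalabanUVNodesN18EnvelopeAtRecord

/-!
# BalabanUVNodes ∕ node N18 = NE5 — TOWER-KEYED ONE-APPLICATION FACES: `N18At` reads the functionals only on the window; comap + window
# agreement; the matching slot closer of `S_N18 RRec` — the shape the RATE-RECORD HOME of record (node00-def-RR-1 INTENT-1, layer B
# `u3OfRecord₁₁ w u k = ⟨u.levelCarriers k, Window w.γ, w.γ, u.κ, u.EA k, u.EB k, u.θ₅, u.C₅, …⟩`) consumes in ONE application

Cell `pub-ymgap`, HUMAN RULING D-0062 (Track A), R134 seat `pub-ymgap-dag-n18-d` (strategy s2: by-name knit at the ₁₁ record), generation 0, module 3.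
THEOREMS ONLY (0 `def`); imports this seat's module 1 only (p451455: `n18At_comap`, `s_N18_of_comap`, the H-layer faces); modifies nothing;
`--supports stmt-QuantumFields-19676` (K3).

WHY.  The rate-record home being typed (node00-def-RR-1 INTENT-1, pub-ymgap INBOX 2026-08-26T14:54:29Z; layer B = seat n22-e) FIXES N18's functionals of
record: the U3 bundle of a record is a LEVEL `k` of ONE tower of objects `u : U3Objects₁₁` — carriers `u.levelCarriers k` (domains `u.Dom` with first-occurrence
run `u.r`, scale `k − r X`, tree length `u.d`, ONE background type `u.B`, transport `u.tr k`), run A's functional `u.E k`, run B's family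
`b ↦ u.E (k+1) ∘ prependCoupling b`, window `T4OutputRate.Window w.γ`, radius `w.γ`, and K-UNIFORM letters `u.κ u.θ₅ u.C₅ …`.  Module 1's closer
`s_N18_of_comap` asks the record's functionals to BE the pull-backs `fun g U X => EA g (φA U) (φD X)` of an END's functionals along maps of carriers — an
equation of functions.  For the home's FIXED `u.E` the usable form is AGREEMENT ON THE WINDOW: `N18At` is a statement about the values of run A's functional at
transported backgrounds and of run B's family, for coupling sequences IN THE WINDOW only.  This file types exactly that:
* `n18At_congr` — `N18At` at a bundle passes to any functionals agreeing with the bundle's on `W × BgB × Dom` (run A read at transported backgrounds), same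
  carriers and letters (NE9 ∕ read-out letters free);
* `n18At_comap_congr` — module 1's `n18At_comap` followed by `n18At_congr`: along maps of carriers `C′ → C` preserving scale ∕ tree length and commuting with
  the transports, `N18At` at a bundle on `C` gives `N18At` on `C′` for ANY functionals `EA′, EB′` on `C′` that AGREE ON THE WINDOW with the pulled-back ones;
* `s_N18_of_comap_agree` — the home-friendliest closer, stated on the record's OWN FIELDS (no bundle equation): maps out of `R.u3.C`, agreement on
  `R.u3.W`, letter slack (`N18Knit.ne5_comap` + `ne5_mono`);
* `s_N18_of_comap_congr` — the matching refinement-generic closer: `S_N18 RRec` for every `RRec` whose bundles of record carry «a bundle `u` with `N18At u`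
  (module 1's H-layer bundle on `TwoRuns.carriers`, n18-a's primitive-rate bundle, King's model bundle), maps of the record's carriers into `u.C` with the
  three compatibilities, and window agreement of the record's functionals with the pull-backs».  At the home: `C′ := u.levelCarriers k`, `EA′ := u.EA k`,
  `EB′ := u.EB k`; what N18's content then owes per level is an END bundle + the maps + the agreement — i.e. that W1's localized history functional `u.E`
  IS (on the window) the represented output of the step model the END is applied to.
HONEST FRAMING.  Kernel bookkeeping (`intro ∕ rw ∕ exact`); 0 sorry; restates nothing (module 1's `n18At_comap` and `N18Knit.ne5_family_comap` are used BY
NAME; the NE5-level congruence `Support/B13OutKPFormRecord.ne5_congr` is the same remark for ONE pair of functionals — not imported, to keep this module on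
module 1's import cone).  No rate-record home has landed; NE5 NOT IN PRINT ∕ NOT proved; N18 NOT discharged (typed 28∕28 · discharged 5∕28 unmoved).  One finite
four-torus at fixed ε; NOT infinite volume, NOT OS on ℝ⁴, NOT a mass gap, NOT Clay.
-/

noncomputable section

namespace YMDAG.N18.HLayer

open Literature.MathematicalPhysics.QuantumFieldTheory.Balaban1983to89
open Literature.MathematicalPhysics.QuantumFieldTheory.Balaban1983to89.T4Continuum
open Literature.MathematicalPhysics.QuantumFieldTheory.Balaban1983to89.T4OutputRate (Carriers Functional)
open Summit.QuantumFields.YangMills.BalabanUVNodes.N18Knit (ne5_comap ne5_mono)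
open YMDAG.UVSplit

/-- **`N18At` READS THE FUNCTIONALS ONLY ON THE WINDOW** [bookkeeping]: if run A's functionals `EA′, EA` agree at every coupling sequence of the window,
every TRANSPORTED run-B background and every domain, and run B's families `EB′ b, EB b` agree on the window for every member `b ∈ ]0, γ]`, then `N18At`
passes from `(EA, EB)` to `(EA′, EB′)` at the same carriers, window, radius, `κ`, `θ`, `C₅` (NE9 ∕ read-out letters free).  The form in which a home whose
functionals are FIXED objects of record (W1's `E k`, `E (k+1) ∘ prependCoupling b`) takes `N18At` from an END whose functionals are the step model's
represented outputs. [folklore] -/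
theorem n18At_congr {C : Carriers} {W : Set (ℕ → ℝ)} {γ κ : ℝ} {EA EA' : Functional C C.BgA} {EB EB' : ℝ → Functional C C.BgB}
    {θ C₅ : ℝ} {Λ : ℕ → ℕ → ℝ} {C₉ ωm cr ρ : ℝ}
    (hA : ∀ g ∈ W, ∀ (U : C.BgB) (X : C.Dom), EA' g (C.transport U) X = EA g (C.transport U) X)
    (hB : ∀ b : ℝ, 0 < b → b ≤ γ → ∀ g ∈ W, ∀ (U : C.BgB) (X : C.Dom), EB' b g U X = EB b g U X)
    (h : N18At ⟨C, W, γ, κ, EA, EB, θ, C₅, Λ, C₉, ωm, cr, ρ⟩) (Λ' : ℕ → ℕ → ℝ) (C₉' ωm' cr' ρ' : ℝ) :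
    N18At ⟨C, W, γ, κ, EA', EB', θ, C₅, Λ', C₉', ωm', cr', ρ'⟩ := by
  intro b hb hbγ g hg U X
  show |EA' g (C.transport U) X - EB' b g U X| ≤ C₅ * θ ^ C.scale X * Real.exp (-(κ * C.d X))
  rw [hA g hg U X, hB b hb hbγ g hg U X]
  exact h b hb hbγ g hg U X

/-- **COMAP + WINDOW AGREEMENT** [bookkeeping]: along maps of domains and backgrounds `C′ → C` preserving the scale and the tree length and commuting with
the transports (module 1's `n18At_comap`), `N18At` at a bundle on `C` gives `N18At` on `C′` for ANY functionals `EA′ : Functional C′ C′.BgA`,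
`EB′ : ℝ → Functional C′ C′.BgB` that AGREE ON THE WINDOW with the pulled-back ones — run A at transported backgrounds:
`EA′ g (C′.transport U) X = EA g (φA (C′.transport U)) (φD X)`; run B member by member: `EB′ b g U X = EB b g (φB U) (φD X)`. [folklore] -/
theorem n18At_comap_congr {C C' : Carriers} (φD : C'.Dom → C.Dom) (φA : C'.BgA → C.BgA) (φB : C'.BgB → C.BgB)
    (hscale : ∀ X, C.scale (φD X) = C'.scale X) (hd : ∀ X, C.d (φD X) = C'.d X)
    (htr : ∀ U, φA (C'.transport U) = C.transport (φB U))
    {W : Set (ℕ → ℝ)} {γ κ : ℝ} {EA : Functional C C.BgA} {EB : ℝ → Functional C C.BgB} {θ C₅ : ℝ} {Λ : ℕ → ℕ → ℝ}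
    {C₉ ωm cr ρ : ℝ} (h : N18At ⟨C, W, γ, κ, EA, EB, θ, C₅, Λ, C₉, ωm, cr, ρ⟩)
    {EA' : Functional C' C'.BgA} {EB' : ℝ → Functional C' C'.BgB}
    (hA : ∀ g ∈ W, ∀ (U : C'.BgB) (X : C'.Dom), EA' g (C'.transport U) X = EA g (φA (C'.transport U)) (φD X))
    (hB : ∀ b : ℝ, 0 < b → b ≤ γ → ∀ g ∈ W, ∀ (U : C'.BgB) (X : C'.Dom), EB' b g U X = EB b g (φB U) (φD X))
    (Λ' : ℕ → ℕ → ℝ) (C₉' ωm' cr' ρ' : ℝ) :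
    N18At ⟨C', W, γ, κ, EA', EB', θ, C₅, Λ', C₉', ωm', cr', ρ'⟩ :=
  n18At_congr (EA := fun g U X => EA g (φA U) (φD X)) (EB := fun b g U X => EB b g (φB U) (φD X)) hA hB
    (n18At_comap φD φA φB hscale hd htr h Λ' C₉' ωm' cr' ρ') Λ' C₉' ωm' cr' ρ'

variable {N : ℕ} [NeZero N]

/-- **`S_N18 RRec` FOR EVERY RATE-RECORD PREDICATE WHOSE BUNDLES AGREE ON THE WINDOW, THROUGH MAPS OF CARRIERS, WITH A BUNDLE CARRYING `N18At`**
[bookkeeping] — the tower-keyed one-application closer: the clause is «a U3 bundle `u` with `N18At u`; maps of the record's U3 carriers `C′` into `u.C`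
preserving scale ∕ tree length and commuting with the transports; and the record's OWN functionals `EA′, EB′` agreeing on `u.W` with the pull-backs;
`R.u3 = ⟨C′, u.W, u.γ, u.κ, EA′, EB′, u.θ, u.C₅, …⟩`».  For the home of record: `C′ := u.levelCarriers k`, `EA′ := u.EA k`, `EB′ := u.EB k` of the tower
of objects, `u` := an END's bundle at window `Window w.γ` with the record's letters. [folklore] -/
theorem s_N18_of_comap_congr (RRec : RateRecordPred N)
    (h : ∀ (F : T4Family) (D : Datum F N) (g₀ : ℕ → ℝ) (os : List (ULoop F)) (R : RateCarriers N), RRec F D g₀ os R →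
      ∃ (u : U3Carriers) (C' : Carriers) (φD : C'.Dom → u.C.Dom) (φA : C'.BgA → u.C.BgA) (φB : C'.BgB → u.C.BgB)
        (EA' : Functional C' C'.BgA) (EB' : ℝ → Functional C' C'.BgB) (Λ' : ℕ → ℕ → ℝ) (C₉' ωm' cr' ρ' : ℝ),
        (∀ X, u.C.scale (φD X) = C'.scale X) ∧ (∀ X, u.C.d (φD X) = C'.d X) ∧ (∀ U, φA (C'.transport U) = u.C.transport (φB U)) ∧
        N18At u ∧
        (∀ g ∈ u.W, ∀ (U : C'.BgB) (X : C'.Dom), EA' g (C'.transport U) X = u.EA g (φA (C'.transport U)) (φD X)) ∧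
        (∀ b : ℝ, 0 < b → b ≤ u.γ → ∀ g ∈ u.W, ∀ (U : C'.BgB) (X : C'.Dom), EB' b g U X = u.EB b g (φB U) (φD X)) ∧
        R.u3 = ⟨C', u.W, u.γ, u.κ, EA', EB', u.θ, u.C₅, Λ', C₉', ωm', cr', ρ'⟩) :
    S_N18 RRec := by
  intro F D g₀ os R hR
  obtain ⟨u, C', φD, φA, φB, EA', EB', Λ', C₉', ωm', cr', ρ', hscale, hd, htr, hu, hA, hB, hR3⟩ := h F D g₀ os R hR
  rw [hR3]
  obtain ⟨C, W, γ, κ, EA, EB, θ, C₅, Λ, C₉, ωm, cr, ρ⟩ := u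
  exact n18At_comap_congr φD φA φB hscale hd htr hu hA hB Λ' C₉' ωm' cr' ρ'

/-- **`S_N18 RRec` FROM THE RECORD's OWN FIELDS — NO BUNDLE EQUATION, LETTERS WITH SLACK** [bookkeeping] — the home-friendliest closer: for every
bundle `R` of record exhibit a U3 bundle `u` with `N18At u`, maps OUT OF the record's carriers `R.u3.C` into `u.C` (scale ∕ tree length preserved,
transports commuting), AGREEMENT on the record's window `R.u3.W` of the record's functionals `R.u3.EA` (at transported backgrounds) and `R.u3.EB b`
(`b ∈ ]0, R.u3.γ]`) with the pull-backs of `u`'s, and LETTER SLACK `R.u3.W ⊆ u.W`, `R.u3.γ ≤ u.γ`, `R.u3.κ ≤ u.κ`, `0 ≤ u.θ ≤ R.u3.θ`,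
`0 ≤ u.C₅ ≤ R.u3.C₅` (`N18Knit.ne5_comap` + `N18Knit.ne5_mono` + the window rewrite).  For the home of record (`R.u3 = u3OfRecord₁₁ w u k` after
`subst`) every hypothesis is about the tower's level-`k` objects directly. [folklore] -/
theorem s_N18_of_comap_agree (RRec : RateRecordPred N)
    (h : ∀ (F : T4Family) (D : Datum F N) (g₀ : ℕ → ℝ) (os : List (ULoop F)) (R : RateCarriers N), RRec F D g₀ os R →
      ∃ (u : U3Carriers) (φD : R.u3.C.Dom → u.C.Dom) (φA : R.u3.C.BgA → u.C.BgA) (φB : R.u3.C.BgB → u.C.BgB),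
        (∀ X, u.C.scale (φD X) = R.u3.C.scale X) ∧ (∀ X, u.C.d (φD X) = R.u3.C.d X) ∧
        (∀ U, φA (R.u3.C.transport U) = u.C.transport (φB U)) ∧ N18At u ∧
        (∀ g ∈ R.u3.W, ∀ (U : R.u3.C.BgB) (X : R.u3.C.Dom),
          R.u3.EA g (R.u3.C.transport U) X = u.EA g (φA (R.u3.C.transport U)) (φD X)) ∧
        (∀ b : ℝ, 0 < b → b ≤ R.u3.γ → ∀ g ∈ R.u3.W, ∀ (U : R.u3.C.BgB) (X : R.u3.C.Dom),
          R.u3.EB b g U X = u.EB b g (φB U) (φD X)) ∧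
        R.u3.W ⊆ u.W ∧ R.u3.γ ≤ u.γ ∧ R.u3.κ ≤ u.κ ∧ 0 ≤ u.θ ∧ u.θ ≤ R.u3.θ ∧ 0 ≤ u.C₅ ∧ u.C₅ ≤ R.u3.C₅) :
    S_N18 RRec := by
  intro F D g₀ os R hR
  obtain ⟨u, φD, φA, φB, hscale, hd, htr, hu, hA, hB, hW, hγ, hκ, hθ0, hθ, hC0, hC⟩ := h F D g₀ os R hR
  intro b hb hbγ g hg U X
  have h5 := ne5_mono (ne5_comap (C' := R.u3.C) φD φA φB hscale hd htr (hu b hb (hbγ.trans hγ))) hW hκ hθ0 hθ hC0 hC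
  rw [hA g hg U X, hB b hb hbγ g hg U X]
  exact h5 g hg U X

end YMDAG.N18.HLayer

end
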